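import Summits.NavierStokesRegularity.NavierStokesRegularity.Theorems.SqueezeCycleSingularProfileOfNontrivialMorreyPotential
import Summits.NavierStokesRegularity.NavierStokesRegularity.Theorems.SqueezeCycleSingularProfileOfNontrivialProbeBounds
import Literature.Analysis.FluidPDE.NormalisedPressureLpClass
import Literature.Analysis.FluidPDE.LocalPressureOscillation
import Literature.Analysis.FluidPDE.LerayPressureDecayProofs
import Literature.Analysis.FluidPDE.LocalLerayPressureDecompositionProofs
import Mathlib.Analysis.Calculus.BumpFunction.FiniteDimension

/-!
# Route SqueezeCycle · item `SingularProfileOfNontrivial` (stmt-NavierStokesRegularity-15368):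
# the oscillation of `Q[v]` on the unit ball for MORREY slices (Calderón–Zygmund near, Morrey far)

Helper file (theorems only). For `v ∈ C⁴` with `∫_{B(x,r)} |v|² ≤ A r` (`r ≥ 1`):
`∫_{B(0,1)} |Q[v] − (Q[v])_{B(0,1)}|^{3/2} ≤ K₁ ∫_{B(0,3)} |v|³ + K₂ A^{3/2}` (`exists_slice_oscillation_bound`):
split `Q[v] = Q[χv] + R` with a smooth cutoff `χ` (`= 1` on `B(0,2)`, support in `B(0,3)`); the remainder
is `≤ K_r A` on the unit ball (far potentials by the dyadic Morrey bound, the smooth part of the near kernel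
by two integrations by parts; the singular parts agree since the germs of `v`, `χv` agree on `B(0,2)`), and
`∫|Q[χv]|^{3/2} ≤ K_c ∫|χv|³` by the tree's Calderón–Zygmund bound for the normalised pressure
(Kang–Miura–Tsai 2021 §8 "p_loc / p_far" in scale-invariant form).

References: T. Tao, Anal. PDE 6 (2013), §4, proof of Lemma 4.1 (i) [Tao2011]; D. Albritton, T. Barker,
J. Math. Fluid Mech. 21 (2019) = arXiv:1811.00502, §1, §3 [AlbrittonBarker2019]; G. Koch, N. Nadirashvili,
G. Seregin, V. Šverák, Acta Math. 203 (2009) [KochNadirashviliSereginSverak2009].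
K. Kang, H. Miura, T.-P. Tsai, IMRN 2021 = arXiv:1812.10509, §8 [KangMiuraTsai2020].
-/

noncomputable section

-- the sub-problem namespace repeats the summit name (D-0017 layout `Summit.<S>.<P>.Theorems`)
set_option linter.dupNamespace false
-- nested operator types `ℝ³ →L[ℝ] ℝ³ →L[ℝ] ℝ³ →L[ℝ] ℝ` (pressure kernels)
set_option maxSynthPendingDepth 3

namespace Summit.NavierStokesRegularity.NavierStokesRegularity.Theorems.SingularProfile

open MeasureTheory Set Filter Metric Function
open _root_.Topology
open scoped ENNReal NNReal Laplacian ContDiff RealInnerProductSpace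
open Literature.Analysis.FluidPDE
open Literature.Analysis.FluidPDE.FourierNS (HasDecay)

/-- `G[v] = ∂ᵢ∂ⱼ(vᵢvⱼ)` at a point depends only on the germ of `v` there. [folklore] -/
theorem pressureSource_congr_of_eventuallyEq
    {v w : (EuclideanSpace ℝ (Fin 3)) → (EuclideanSpace ℝ (Fin 3))} {y : EuclideanSpace ℝ (Fin 3)}
    (h : v =ᶠ[𝓝 y] w) : pressureSource v y = pressureSource w y := by
  have h1 : (fun z => convect v v z + VectorCalculus.divergence v z • v z) =ᶠ[𝓝 y]
      fun z => convect w w z + VectorCalculus.divergence w z • w z := by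
    filter_upwards [h.eventually_nhds, h] with z hz hz0
    have hD : fderiv ℝ v z = fderiv ℝ w z := Filter.EventuallyEq.fderiv_eq (show v =ᶠ[𝓝 z] w from hz)
    simp only [convect, VectorCalculus.divergence, hD, hz0]
  unfold pressureSource
  simp only [VectorCalculus.divergence] at h1 ⊢
  rw [h1.fderiv_eq]

/-- **The cutoff remainder is bounded by the Morrey constant.** There is a universal `Kr` such
that for `v ∈ C²` with `∫_{B(x,r)}|v|² ≤ A r` (`r ≥ 1`) and a smooth cutoff `χ` (`χ = 1` on
`B(0,2)`, `|χ| ≤ 1`), `|Q[v](x) − Q[χv](x)| ≤ Kr A` on the unit ball: the far potentials are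
each `≤ K A` (`exists_bound_farPotential_morrey`); in the near potentials the singular parts
`Γ₀^{1/2,1} * G` agree on `B(0,1)` (the germs of `v`, `χv` agree on `B(0,2)`), and the smooth
compactly supported remainder `Γ₀^{1,2} − Γ₀^{1/2,1}` is moved onto `v ⊗ v` by two integrations
by parts (`≤ M ∫_{B̄(x,2)}|v|² ≤ 3 M A`). [folklore] -/
theorem exists_bound_pressurePotential_sub_cutoff :
    ∃ Kr : ℝ, 0 ≤ Kr ∧ ∀ (v : (EuclideanSpace ℝ (Fin 3)) → (EuclideanSpace ℝ (Fin 3))) (A : ℝ)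
      (χ : (EuclideanSpace ℝ (Fin 3)) → ℝ), ContDiff ℝ 2 v →
      (∀ (x : EuclideanSpace ℝ (Fin 3)) (r : ℝ), 1 ≤ r → ∫ y in ball x r, ‖v y‖ ^ 2 ≤ A * r) →
      ContDiff ℝ 2 χ → (∀ y ∈ ball (0 : EuclideanSpace ℝ (Fin 3)) 2, χ y = 1) → (∀ y, |χ y| ≤ 1) →
      ∀ x ∈ ball (0 : EuclideanSpace ℝ (Fin 3)) 1,
        |pressurePotential v x - pressurePotential (fun y => χ y • v y) x| ≤ Kr * A := by
  obtain ⟨Kf, hKf0, hKf⟩ := exists_bound_farPotential_morrey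
  -- the smooth compactly supported kernel `Ψ = Γ₀^{1,2} − Γ₀^{1/2,1} = Γ∞^{1/2,1} − Γ∞^{1,2}`
  have hh1 : (0 : ℝ) < 2⁻¹ * 1 := by norm_num
  have hh2 : (2⁻¹ * 1 : ℝ) < 2⁻¹ * 2 := by norm_num
  set Ψ : (EuclideanSpace ℝ (Fin 3)) → ℝ := fun z => newtonFar (2⁻¹ * 1) (2⁻¹ * 2) z - newtonFar 1 2 z
    with hΨ
  have hΨs : ContDiff ℝ 2 Ψ := (contDiff_newtonFar hh1 hh2).sub (contDiff_newtonFar one_pos one_lt_two)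
  have hΨ0 : ∀ z, 2 ≤ ‖z‖ → Ψ z = 0 := fun z hz => by
    simp only [hΨ]
    rw [newtonFar_eq_newtonKernel hh1.le hh2 (by linarith : (2⁻¹ * 2 : ℝ) ≤ ‖z‖),
      newtonFar_eq_newtonKernel zero_le_one one_lt_two hz, sub_self]
  have hΨsupp : tsupport Ψ ⊆ closedBall (0 : EuclideanSpace ℝ (Fin 3)) 2 := by
    refine closure_minimal (fun z hz => ?_) isClosed_closedBall
    rw [mem_closedBall_zero_iff]
    by_contra hlt
    exact hz (hΨ0 z (not_le.1 hlt).le)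
  have hΨc : HasCompactSupport Ψ := HasCompactSupport.of_support_subset_isCompact
    (isCompact_closedBall 0 2) (subset_closure.trans hΨsupp)
  obtain ⟨MΨ, hMΨ⟩ := ((hΨs.fderiv_right (m := 1) le_rfl).continuous_fderiv
    one_ne_zero).bounded_above_of_compact_support ((hΨc.fderiv (𝕜 := ℝ)).fderiv (𝕜 := ℝ))
  have hMΨ0 : 0 ≤ MΨ := (norm_nonneg _).trans (hMΨ 0)
  have hD2Ψ0 : ∀ z, z ∉ closedBall (0 : EuclideanSpace ℝ (Fin 3)) 2 → fderiv ℝ (fderiv ℝ Ψ) z = 0 :=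
    fun z hz => image_eq_zero_of_notMem_tsupport fun h =>
      hz (hΨsupp (tsupport_fderiv_subset ℝ (tsupport_fderiv_subset ℝ h)))
  refine ⟨2 * Kf + 6 * MΨ, by positivity, fun v A χ hv2 hA hχ hχ1 hχle x hx => ?_⟩
  have hvc := hv2.continuous
  have hA0 : 0 ≤ A := morrey_const_nonneg (w := fun y => ‖v y‖ ^ 2) (fun y => sq_nonneg _) hA
  set w : (EuclideanSpace ℝ (Fin 3)) → (EuclideanSpace ℝ (Fin 3)) := fun y => χ y • v y with hw
  have hw2 : ContDiff ℝ 2 w := hχ.smul hv2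
  have hwc := hw2.continuous
  have hwle : ∀ y, ‖w y‖ ≤ ‖v y‖ := fun y => by
    rw [hw, norm_smul, Real.norm_eq_abs]
    exact mul_le_of_le_one_left (norm_nonneg _) (hχle y)
  -- `w` is a Morrey field with the same constant
  have hAw : ∀ (x : EuclideanSpace ℝ (Fin 3)) (r : ℝ), 1 ≤ r → ∫ y in ball x r, ‖w y‖ ^ 2 ≤ A * r := by
    intro x' r hr
    have h1 : IntegrableOn (fun y => ‖w y‖ ^ 2) (ball x' r) volume :=
      ((hwc.norm.pow 2).continuousOn.integrableOn_compact (isCompact_closedBall x' r)).mono_set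
        ball_subset_closedBall
    have h2 : IntegrableOn (fun y => ‖v y‖ ^ 2) (ball x' r) volume :=
      ((hvc.norm.pow 2).continuousOn.integrableOn_compact (isCompact_closedBall x' r)).mono_set
        ball_subset_closedBall
    exact (setIntegral_mono_on h1 h2 measurableSet_ball fun y _ =>
      pow_le_pow_left₀ (norm_nonneg _) (hwle y) 2).trans (hA x' r hr)
  -- the far potentials
  have hfar : |farPotential 1 2 v x - farPotential 1 2 w x| ≤ 2 * Kf * A := by
    have h1 := hKf v A hvc hA x
    have h2 := hKf w A hwc hAw x
    calc |farPotential 1 2 v x - farPotential 1 2 w x|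
        ≤ |farPotential 1 2 v x| + |farPotential 1 2 w x| := abs_sub _ _
      _ ≤ Kf * A + Kf * A := add_le_add h1 h2
      _ = 2 * Kf * A := by ring
  -- the germs of `v` and `w` agree on `B(0,2)`, hence so do the sources
  have hsrc : ∀ y ∈ ball (0 : EuclideanSpace ℝ (Fin 3)) 2, pressureSource v y = pressureSource w y := by
    intro y hy
    refine pressureSource_congr_of_eventuallyEq ?_
    filter_upwards [isOpen_ball.mem_nhds hy] with z hz
    simp [hw, hχ1 z hz]
  -- the near potentials: split `Γ₀^{1,2} = Γ₀^{1/2,1} + Ψ`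
  have hsplit : ∀ z, newtonNear 1 2 z = newtonNear (2⁻¹ * 1) (2⁻¹ * 2) z + Ψ z := fun z => by
    have := newtonNear_sub_newtonNear 2⁻¹ z
    simp only [hΨ]
    linarith
  have hnear_eq : ∀ (f : (EuclideanSpace ℝ (Fin 3)) → (EuclideanSpace ℝ (Fin 3))), ContDiff ℝ 2 f →
      nearPotential 1 2 f x = nearPotential (2⁻¹ * 1) (2⁻¹ * 2) f x +
        ∫ y, fderiv ℝ (fderiv ℝ Ψ) (x - y) (f y) (f y) := by
    intro f hf
    have hGc : Continuous (pressureSource f) :=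
      (contDiff_pressureSource (n := 0) (by exact_mod_cast hf)).continuous
    have i1 := integrable_nearPotential_integrand hh1.le hh2 hf x
    have i2 : Integrable fun z => Ψ z * pressureSource f (x - z) :=
      (hΨs.continuous.mul (hGc.comp (continuous_const.sub continuous_id))).integrable_of_hasCompactSupport
        hΨc.mul_right
    have e1 : ∫ z, Ψ z * pressureSource f (x - z) = ∫ y, fderiv ℝ (fderiv ℝ Ψ) (x - y) (f y) (f y) := by
      rw [← integral_sub_left_eq_self (fun z => Ψ z * pressureSource f (x - z)) volume x]
      simp only [sub_sub_cancel]
      exact integral_comp_sub_mul_pressureSource hΨs hΨc hf x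
    rw [nearPotential, nearPotential, ← e1, ← integral_add i1 i2]
    refine integral_congr_ae (Eventually.of_forall fun z => ?_)
    simp only [hsplit z, add_mul]
  -- the singular parts agree on the unit ball
  have hsing : nearPotential (2⁻¹ * 1) (2⁻¹ * 2) v x = nearPotential (2⁻¹ * 1) (2⁻¹ * 2) w x := by
    rw [nearPotential, nearPotential]
    refine integral_congr_ae (Eventually.of_forall fun z => ?_)
    by_cases hz : 1 ≤ ‖z‖
    · simp only [newtonNear_eq_zero hh1.le hh2 (by linarith : (2⁻¹ * 2 : ℝ) ≤ ‖z‖), zero_mul]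
    · rw [not_le] at hz
      have hxz : x - z ∈ ball (0 : EuclideanSpace ℝ (Fin 3)) 2 := by
        rw [mem_ball_zero_iff] at hx ⊢
        calc ‖x - z‖ ≤ ‖x‖ + ‖z‖ := norm_sub_le _ _
          _ < 1 + 1 := add_lt_add hx hz
          _ = 2 := by norm_num
      simp only [hsrc (x - z) hxz]
  -- the smooth remainders are each `≤ 3 MΨ A`
  have hrem : ∀ (f : (EuclideanSpace ℝ (Fin 3)) → (EuclideanSpace ℝ (Fin 3))), Continuous f →
      (∀ (x : EuclideanSpace ℝ (Fin 3)) (r : ℝ), 1 ≤ r → ∫ y in ball x r, ‖f y‖ ^ 2 ≤ A * r) →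
      |∫ y, fderiv ℝ (fderiv ℝ Ψ) (x - y) (f y) (f y)| ≤ 3 * MΨ * A := by
    intro f hf hAf
    have henergy : ∫ y in closedBall x (1 * 2), ‖f y‖ ^ 2 ≤ A * (1 * (2 + 1)) :=
      integral_closedBall_sq_le_of_morrey hf hAf x le_rfl (by norm_num)
    rw [one_mul, one_mul] at henergy
    set Bw : Set (EuclideanSpace ℝ (Fin 3)) := closedBall x 2 with hBw
    have hpt : ∀ y, ‖fderiv ℝ (fderiv ℝ Ψ) (x - y) (f y) (f y)‖ ≤
        MΨ * Bw.indicator (fun y => ‖f y‖ ^ 2) y := by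
      intro y
      by_cases hy : y ∈ Bw
      · rw [Set.indicator_of_mem hy]
        calc ‖fderiv ℝ (fderiv ℝ Ψ) (x - y) (f y) (f y)‖
            ≤ ‖fderiv ℝ (fderiv ℝ Ψ) (x - y) (f y)‖ * ‖f y‖ := ContinuousLinearMap.le_opNorm _ _
          _ ≤ ‖fderiv ℝ (fderiv ℝ Ψ) (x - y)‖ * ‖f y‖ * ‖f y‖ := by
              gcongr; exact ContinuousLinearMap.le_opNorm _ _
          _ ≤ MΨ * ‖f y‖ * ‖f y‖ := by gcongr; exact hMΨ _
          _ = MΨ * ‖f y‖ ^ 2 := by ring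
      · have hxy : x - y ∉ closedBall (0 : EuclideanSpace ℝ (Fin 3)) 2 := by
          intro hmem
          apply hy
          rw [mem_closedBall_zero_iff] at hmem
          rw [hBw, mem_closedBall, dist_eq_norm, ← norm_neg, neg_sub]
          exact hmem
        rw [hD2Ψ0 (x - y) hxy, Set.indicator_of_notMem hy]
        simp
    have hind : Integrable (fun y => MΨ * Bw.indicator (fun y => ‖f y‖ ^ 2) y) := by
      refine Integrable.const_mul ?_ _
      rw [integrable_indicator_iff measurableSet_closedBall]
      exact (hf.norm.pow 2).continuousOn.integrableOn_compact (isCompact_closedBall _ _)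
    have hle := norm_integral_le_of_norm_le hind (Eventually.of_forall hpt)
    rw [integral_const_mul, integral_indicator measurableSet_closedBall, Real.norm_eq_abs] at hle
    calc |∫ y, fderiv ℝ (fderiv ℝ Ψ) (x - y) (f y) (f y)| ≤ MΨ * ∫ y in Bw, ‖f y‖ ^ 2 := hle
      _ ≤ MΨ * (A * (2 + 1)) := mul_le_mul_of_nonneg_left henergy hMΨ0
      _ = 3 * MΨ * A := by ring
  have hnear : |nearPotential 1 2 v x - nearPotential 1 2 w x| ≤ 6 * MΨ * A := by
    rw [hnear_eq v hv2, hnear_eq w hw2, hsing]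
    have h1 := hrem v hvc hA
    have h2 := hrem w hwc hAw
    rw [show nearPotential (2⁻¹ * 1) (2⁻¹ * 2) w x + (∫ y, fderiv ℝ (fderiv ℝ Ψ) (x - y) (v y) (v y)) -
        (nearPotential (2⁻¹ * 1) (2⁻¹ * 2) w x + ∫ y, fderiv ℝ (fderiv ℝ Ψ) (x - y) (w y) (w y)) =
        (∫ y, fderiv ℝ (fderiv ℝ Ψ) (x - y) (v y) (v y)) - ∫ y, fderiv ℝ (fderiv ℝ Ψ) (x - y) (w y) (w y)
        by ring]
    calc _ ≤ |∫ y, fderiv ℝ (fderiv ℝ Ψ) (x - y) (v y) (v y)| +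
          |∫ y, fderiv ℝ (fderiv ℝ Ψ) (x - y) (w y) (w y)| := abs_sub _ _
      _ ≤ 3 * MΨ * A + 3 * MΨ * A := add_le_add h1 h2
      _ = 6 * MΨ * A := by ring
  calc |pressurePotential v x - pressurePotential w x|
      = |-(nearPotential 1 2 v x - nearPotential 1 2 w x) - (farPotential 1 2 v x - farPotential 1 2 w x)| := by
        simp only [pressurePotential]; ring_nf
    _ ≤ |nearPotential 1 2 v x - nearPotential 1 2 w x| + |farPotential 1 2 v x - farPotential 1 2 w x| := by
        calc _ ≤ |-(nearPotential 1 2 v x - nearPotential 1 2 w x)| +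
              |farPotential 1 2 v x - farPotential 1 2 w x| := abs_sub _ _
          _ = _ := by rw [abs_neg]
    _ ≤ 6 * MΨ * A + 2 * Kf * A := add_le_add hnear hfar
    _ = (2 * Kf + 6 * MΨ) * A := by ring

/-- **Calderón–Zygmund for the pressure potential of a `C²_c` field**:
`∫ |Q[w]|^{3/2} ≤ K_c ∫ |w|³` (`Q[w] = normalisedPressure w` for `w ∈ C²` with `|w|² ∈ L¹`, and
the tree's `L^{3/2}` bound for the normalised pressure, raised to the power `3/2`).
[cite: Stein1970, Ch. II §4.2 Thm 3] -/
theorem exists_lintegral_pressurePotential_le_cube :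
    ∃ Kc : ℝ≥0∞, Kc ≠ ⊤ ∧ ∀ (w : (EuclideanSpace ℝ (Fin 3)) → (EuclideanSpace ℝ (Fin 3))),
      ContDiff ℝ 2 w → HasCompactSupport w →
      ∫⁻ x, ‖pressurePotential w x‖ₑ ^ (3 / 2 : ℝ) ≤ Kc * ∫⁻ y, ‖w y‖ₑ ^ (3 : ℕ) := by
  obtain ⟨C, hC⟩ := stein1970_normalisedPressure_ae_Lp_bound_holds (3 / 2)
    ((ENNReal.lt_div_iff_mul_lt (Or.inl two_ne_zero) (Or.inl ENNReal.ofNat_ne_top)).2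
      (by norm_num))
    (lt_top_iff_ne_top.2 (ENNReal.div_ne_top (by norm_num) (by norm_num)))
  refine ⟨(C : ℝ≥0∞) ^ (3 / 2 : ℝ), ENNReal.rpow_ne_top_of_nonneg (by norm_num) ENNReal.coe_ne_top,
    fun w hw2 hwc => ?_⟩
  have hcont := hw2.continuous
  have hwm : AEStronglyMeasurable w volume := hcont.aestronglyMeasurable
  -- `‖ |w|² ‖ₑ^{3/2} = |w|³`
  have hlin : ∫⁻ x, ‖(‖w x‖ ^ 2 : ℝ)‖ₑ ^ (3 / 2 : ℝ) = ∫⁻ x, ‖w x‖ₑ ^ (3 : ℕ) :=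
    lintegral_congr fun x => enorm_norm_sq_rpow_threeHalves (w x)
  have hK3 : HasCompactSupport fun y => ‖w y‖ ^ 3 :=
    hwc.mono fun y hy h => hy (by simp [h])
  have hL3 : Integrable fun y => ‖w y‖ ^ 3 := (hcont.norm.pow 3).integrable_of_hasCompactSupport hK3
  have hfin : ∫⁻ x, ‖w x‖ₑ ^ (3 : ℕ) ≠ ⊤ := by
    have h := hL3.2
    rw [hasFiniteIntegral_iff_enorm] at h
    refine ne_of_lt (lt_of_le_of_lt (le_of_eq (lintegral_congr fun x => ?_)) h)
    rw [Real.enorm_eq_ofReal (pow_nonneg (norm_nonneg _) 3), ENNReal.ofReal_pow (norm_nonneg _),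
      ofReal_norm]
  have hsq_meas : AEStronglyMeasurable (fun x => ‖w x‖ ^ 2) volume :=
    (continuous_norm.pow 2).comp_aestronglyMeasurable hwm
  have hmem : MemLp (fun x => ‖w x‖ ^ 2) (3 / 2 : ℝ≥0∞) volume := by
    refine ⟨hsq_meas, eLpNorm_threeHalves_lt_top_of_lintegral ?_⟩
    rw [hlin]
    exact hfin
  obtain ⟨_, hbound⟩ := hC w hwm hmem
  have hK2 : HasCompactSupport fun y => ‖w y‖ ^ 2 :=
    hwc.mono fun y hy h => hy (by simp [h])
  have hL2 : Integrable fun y => ‖w y‖ ^ 2 := (hcont.norm.pow 2).integrable_of_hasCompactSupport hK2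
  rw [← normalisedPressure_eq_pressurePotential' hw2 hL2,
    lintegral_rpow_threeHalves_eq (normalisedPressure w) volume, ← hlin, lintegral_rpow_threeHalves_eq]
  calc eLpNorm (normalisedPressure w) (3 / 2 : ℝ≥0∞) volume ^ (3 / 2 : ℝ)
      ≤ ((C : ℝ≥0∞) * eLpNorm (fun x => ‖w x‖ ^ 2) (3 / 2 : ℝ≥0∞) volume) ^ (3 / 2 : ℝ) :=
        ENNReal.rpow_le_rpow hbound (by norm_num)
    _ = (C : ℝ≥0∞) ^ (3 / 2 : ℝ) * eLpNorm (fun x => ‖w x‖ ^ 2) (3 / 2 : ℝ≥0∞) volume ^ (3 / 2 : ℝ) :=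
        ENNReal.mul_rpow_of_nonneg _ _ (by norm_num)

/-- The fixed cutoff: a smooth bump `χ` with `χ = 1` on `B̄(0,2)`, `0 ≤ χ ≤ 1`, support in
`B(0,3)`. [folklore] -/
theorem exists_cutoff : ∃ χ : (EuclideanSpace ℝ (Fin 3)) → ℝ, ContDiff ℝ ∞ χ ∧
    (∀ y ∈ ball (0 : EuclideanSpace ℝ (Fin 3)) 2, χ y = 1) ∧ (∀ y, |χ y| ≤ 1) ∧
    (∀ y, 3 ≤ ‖y‖ → χ y = 0) ∧ HasCompactSupport χ := by
  let χ : ContDiffBump (0 : EuclideanSpace ℝ (Fin 3)) := ⟨2, 3, by norm_num, by norm_num⟩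
  refine ⟨χ, χ.contDiff, fun y hy => χ.one_of_mem_closedBall (ball_subset_closedBall hy),
    fun y => ?_, fun y hy => χ.zero_of_le_dist (by simpa using hy), χ.hasCompactSupport⟩
  rw [abs_of_nonneg (χ.nonneg' y)]
  exact χ.le_one

/-- **The pressure oscillation of a Morrey slice on the unit ball.** There are universal finite
`K₁, K₂` such that for `v ∈ C⁴` with `∫_{B(x,r)}|v|² ≤ A r` (`r ≥ 1`),
`∫_{B(0,1)} |Q[v] − (Q[v])_{B(0,1)}|^{3/2} ≤ K₁ ∫_{B(0,3)} |v|³ + K₂ A^{3/2}`: replace the mean by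
`0` (factor `4`), split `Q[v] = Q[χv] + R` with `|R| ≤ K_r A` on the ball
(`exists_bound_pressurePotential_sub_cutoff`) and `∫|Q[χv]|^{3/2} ≤ K_c ∫|χv|³ ≤ K_c ∫_{B(0,3)}|v|³`
(`exists_lintegral_pressurePotential_le_cube`). [cite: KangMiuraTsai2020, §8 proof of Lemma 3.4 (bounds for p_loc and p_far)] -/
theorem exists_slice_oscillation_bound :
    ∃ K₁ K₂ : ℝ≥0∞, K₁ ≠ ⊤ ∧ K₂ ≠ ⊤ ∧
      ∀ (v : (EuclideanSpace ℝ (Fin 3)) → (EuclideanSpace ℝ (Fin 3))) (A : ℝ), ContDiff ℝ 4 v →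
      (∀ (x : EuclideanSpace ℝ (Fin 3)) (r : ℝ), 1 ≤ r → ∫ y in ball x r, ‖v y‖ ^ 2 ≤ A * r) →
      ∫⁻ x in ball (0 : EuclideanSpace ℝ (Fin 3)) 1,
          ‖pressurePotential v x - ⨍ y in ball (0 : EuclideanSpace ℝ (Fin 3)) 1, pressurePotential v y‖ₑ
            ^ (3 / 2 : ℝ) ≤
        K₁ * (∫⁻ y in ball (0 : EuclideanSpace ℝ (Fin 3)) 3, ‖v y‖ₑ ^ (3 : ℕ)) +
          K₂ * ENNReal.ofReal A ^ (3 / 2 : ℝ) := by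
  obtain ⟨Kr, hKr0, hKr⟩ := exists_bound_pressurePotential_sub_cutoff
  obtain ⟨Kc, hKct, hKc⟩ := exists_lintegral_pressurePotential_le_cube
  obtain ⟨χ, hχs, hχ1, hχle, hχ0, hχc⟩ := exists_cutoff
  set V : ℝ≥0∞ := volume (ball (0 : EuclideanSpace ℝ (Fin 3)) 1) with hV
  have hVt : V ≠ ⊤ := measure_ball_lt_top.ne
  have hV0 : V ≠ 0 := (measure_ball_pos volume _ one_pos).ne'
  refine ⟨8 * Kc, 8 * (V * ENNReal.ofReal Kr ^ (3 / 2 : ℝ)), ENNReal.mul_ne_top (by norm_num) hKct,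
    ENNReal.mul_ne_top (by norm_num) (ENNReal.mul_ne_top hVt
      (ENNReal.rpow_ne_top_of_nonneg (by norm_num) ENNReal.ofReal_ne_top)), fun v A hv4 hA => ?_⟩
  have hv2 : ContDiff ℝ 2 v := hv4.of_le (by norm_num)
  have hvc := hv4.continuous
  have hA0 : 0 ≤ A := morrey_const_nonneg (w := fun y => ‖v y‖ ^ 2) (fun y => sq_nonneg _) hA
  set Q := pressurePotential v with hQ
  set w : (EuclideanSpace ℝ (Fin 3)) → (EuclideanSpace ℝ (Fin 3)) := fun y => χ y • v y with hw
  have hw2 : ContDiff ℝ 2 w := (hχs.of_le (by norm_cast)).smul hv2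
  have hwsupp : HasCompactSupport w := hχc.smul_right
  have hQc : Continuous Q := (contDiff_pressurePotential_morrey hv4 hA).continuous
  have hQint : IntegrableOn Q (ball (0 : EuclideanSpace ℝ (Fin 3)) 1) volume :=
    (hQc.continuousOn.integrableOn_compact (isCompact_closedBall 0 1)).mono_set ball_subset_closedBall
  -- replace the mean by `0`
  have hmean := setLIntegral_rpow_sub_average_le_of_const hV0 hVt hQint 0
  simp only [sub_zero] at hmean
  refine hmean.trans ?_
  -- pointwise splitting on the ball
  have hpt : ∀ x ∈ ball (0 : EuclideanSpace ℝ (Fin 3)) 1, ‖Q x‖ₑ ^ (3 / 2 : ℝ) ≤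
      2 * (‖pressurePotential w x‖ₑ ^ (3 / 2 : ℝ) + ENNReal.ofReal (Kr * A) ^ (3 / 2 : ℝ)) := by
    intro x hx
    have hR := hKr v A χ hv2 hA (hχs.of_le (by norm_cast)) hχ1 hχle x hx
    have h1 : ‖Q x‖ₑ ≤ ‖pressurePotential w x‖ₑ + ENNReal.ofReal (Kr * A) := by
      have e : Q x = pressurePotential w x + (Q x - pressurePotential w x) := by ring
      rw [e]
      refine (enorm_add_le _ _).trans (add_le_add le_rfl ?_)
      rw [Real.enorm_eq_ofReal_abs]
      exact ENNReal.ofReal_le_ofReal hR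
    calc ‖Q x‖ₑ ^ (3 / 2 : ℝ) ≤ (‖pressurePotential w x‖ₑ + ENNReal.ofReal (Kr * A)) ^ (3 / 2 : ℝ) :=
          ENNReal.rpow_le_rpow h1 (by norm_num)
      _ ≤ 2 ^ ((3 / 2 : ℝ) - 1) * (‖pressurePotential w x‖ₑ ^ (3 / 2 : ℝ) +
            ENNReal.ofReal (Kr * A) ^ (3 / 2 : ℝ)) := ENNReal.rpow_add_le_mul_rpow_add_rpow _ _ (by norm_num)
      _ ≤ 2 * (‖pressurePotential w x‖ₑ ^ (3 / 2 : ℝ) + ENNReal.ofReal (Kr * A) ^ (3 / 2 : ℝ)) := by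
          gcongr
          calc (2 : ℝ≥0∞) ^ ((3 / 2 : ℝ) - 1) ≤ 2 ^ (1 : ℝ) :=
                ENNReal.rpow_le_rpow_of_exponent_le (by norm_num) (by norm_num)
            _ = 2 := ENNReal.rpow_one _
  -- the Calderón–Zygmund part: `∫|Q[w]|^{3/2} ≤ Kc ∫_{B(0,3)} |v|³`
  have hcz : ∫⁻ x in ball (0 : EuclideanSpace ℝ (Fin 3)) 1, ‖pressurePotential w x‖ₑ ^ (3 / 2 : ℝ) ≤
      Kc * ∫⁻ y in ball (0 : EuclideanSpace ℝ (Fin 3)) 3, ‖v y‖ₑ ^ (3 : ℕ) := by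
    refine (setLIntegral_le_lintegral _ _).trans ((hKc w hw2 hwsupp).trans (mul_le_mul_right ?_ _))
    rw [← lintegral_indicator measurableSet_ball]
    refine lintegral_mono fun y => ?_
    by_cases hy : y ∈ ball (0 : EuclideanSpace ℝ (Fin 3)) 3
    · rw [indicator_of_mem hy]
      refine pow_le_pow_left' ?_ 3
      rw [hw]
      dsimp only
      rw [enorm_smul]
      refine mul_le_of_le_one_left' ?_
      rw [Real.enorm_eq_ofReal_abs]
      exact ENNReal.ofReal_le_one.2 (hχle y)
    · rw [indicator_of_notMem hy]
      have hy' : 3 ≤ ‖y‖ := by rwa [mem_ball_zero_iff, not_lt] at hy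
      simp [hw, hχ0 y hy']
  -- integrate
  calc 4 * ∫⁻ x in ball (0 : EuclideanSpace ℝ (Fin 3)) 1, ‖Q x‖ₑ ^ (3 / 2 : ℝ)
      ≤ 4 * ∫⁻ x in ball (0 : EuclideanSpace ℝ (Fin 3)) 1,
          2 * (‖pressurePotential w x‖ₑ ^ (3 / 2 : ℝ) + ENNReal.ofReal (Kr * A) ^ (3 / 2 : ℝ)) := by
        gcongr 4 * ?_
        exact setLIntegral_mono' measurableSet_ball fun x hx => hpt x hx
    _ = 8 * ((∫⁻ x in ball (0 : EuclideanSpace ℝ (Fin 3)) 1, ‖pressurePotential w x‖ₑ ^ (3 / 2 : ℝ)) +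
          V * ENNReal.ofReal (Kr * A) ^ (3 / 2 : ℝ)) := by
        rw [lintegral_const_mul' _ _ ENNReal.ofNat_ne_top, lintegral_add_right _ measurable_const,
          setLIntegral_const, ← mul_assoc, mul_comm (ENNReal.ofReal (Kr * A) ^ (3 / 2 : ℝ)) V]
        norm_num
    _ ≤ 8 * (Kc * (∫⁻ y in ball (0 : EuclideanSpace ℝ (Fin 3)) 3, ‖v y‖ₑ ^ (3 : ℕ)) +
          V * (ENNReal.ofReal Kr ^ (3 / 2 : ℝ) * ENNReal.ofReal A ^ (3 / 2 : ℝ))) := by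
        gcongr
        rw [ENNReal.ofReal_mul hKr0, ENNReal.mul_rpow_of_nonneg _ _ (by norm_num)]
    _ = 8 * Kc * (∫⁻ y in ball (0 : EuclideanSpace ℝ (Fin 3)) 3, ‖v y‖ₑ ^ (3 : ℕ)) +
          8 * (V * ENNReal.ofReal Kr ^ (3 / 2 : ℝ)) * ENNReal.ofReal A ^ (3 / 2 : ℝ) := by ring

end Summit.NavierStokesRegularity.NavierStokesRegularity.Theorems.SingularProfile
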